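import Summits.CriticalPhenomena.Ising3DConformalLimit.Theorems.PrimaryAtInfinityWardToMoebiusInvMeasure
import Literature.Probability.LatticeModels.ScalingLimit

/-!
# Ward ⇒ Möbius, part 3: pulling the special-conformal Ward identity back by the inversion

Support file for item stmt-CriticalPhenomena-5357 (`WardToMoebius`, route `PrimaryAtInfinity`,
sub-problem `Ising3DConformalLimit`).

Let `Sₙ : (ℝ³)ⁿ → ℝ` satisfy the weak special-conformal Ward identity with weight `Δ`
(`∫ Sₙ [(2Δ−6)(Σᵢ b·xᵢ) φ + Dφ(x)[(‖xᵢ‖² b − 2(b·xᵢ) xᵢ)ᵢ]] = 0` for all `b` and all smooth `φ`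
compactly supported in the non-coincident configurations). Then the weighted pull-back
`S'ₙ(x) = (∏ᵢ ‖xᵢ‖^{-2Δ}) Sₙ(ιₙ x)` under the coordinatewise unit inversion `ιₙ` is WEAKLY
TRANSLATION INVARIANT on the open set `U₀ = {x non-coincident, all xᵢ ≠ 0}`:
`∫ S'ₙ · ∂_a φ = 0` for every `a ∈ ℝ³` and every smooth `φ` compactly supported in `U₀`
(`weak_translation_invariant_pullback`). This is the infinitesimal form of `K_a = ι P_a ι`
(Di Francesco–Mathieu–Sénéchal 1997, §4.1 (4.14)–(4.18)): test the Ward identity against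
`ψ = ((∏ᵢ ‖·ᵢ‖^{6−2Δ}) φ) ∘ ιₙ`, use `Dιₙ(y)[W_a(y)] = (a,…,a)` (part 1) so that the weight's
derivative cancels the multiplier `(2Δ−6) Σᵢ a·yᵢ`, and change variables `y = ιₙ x` (Jacobian
`∏ᵢ ‖xᵢ‖⁻⁶`, part 1).

References: Di Francesco–Mathieu–Sénéchal, *Conformal Field Theory* (1997) §4.1–4.3; the calculus
is folklore. No definitions are introduced.
-/

noncomputable section

open MeasureTheory EuclideanGeometry Real Set Function Filter Literature.Probability.LatticeModels
open scoped RealInnerProductSpace Topology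

namespace Summit.CriticalPhenomena.Ising3DConformalLimit.WardToMoebius

variable {n : ℕ}

/-! ### The norm weights `∏ᵢ ‖xᵢ‖ ^ p` -/

/-- The norm weight `∏ᵢ ‖xᵢ‖^p` is positive at configurations avoiding the origin. [folklore] -/
theorem normWeight_pos {x : Fin n → EuclideanSpace ℝ (Fin 3)} (hx : ∀ i, x i ≠ 0) (p : ℝ) :
    0 < ∏ i, ‖x i‖ ^ p :=
  Finset.prod_pos fun i _ => Real.rpow_pos_of_pos (norm_pos_iff.2 (hx i)) p

/-- Additivity of the norm weights in the exponent, at configurations avoiding the origin.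
[folklore] -/
theorem normWeight_mul {x : Fin n → EuclideanSpace ℝ (Fin 3)} (hx : ∀ i, x i ≠ 0) (p q : ℝ) :
    (∏ i, ‖x i‖ ^ p) * ∏ i, ‖x i‖ ^ q = ∏ i, ‖x i‖ ^ (p + q) := by
  rw [← Finset.prod_mul_distrib]
  exact Finset.prod_congr rfl fun i _ => (Real.rpow_add (norm_pos_iff.2 (hx i)) p q).symm

/-- `‖w‖ ^ p = (‖w‖ ^ 2) ^ (p / 2)` (real powers). [folklore] -/
theorem norm_rpow_eq_norm_sq_rpow (w : EuclideanSpace ℝ (Fin 3)) (p : ℝ) :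
    ‖w‖ ^ p = (‖w‖ ^ 2) ^ (p / 2) := by
  rw [show ‖w‖ ^ 2 = ‖w‖ ^ (2 : ℝ) by norm_cast, ← Real.rpow_mul (norm_nonneg w)]
  congr 1; ring

/-- Derivative of one factor `x ↦ ‖xᵢ‖^p` of the norm weight at a configuration with `xᵢ ≠ 0`.
[folklore] -/
theorem hasFDerivAt_norm_apply_rpow {x : Fin n → EuclideanSpace ℝ (Fin 3)} (i : Fin n)
    (hx : x i ≠ 0) (p : ℝ) :
    HasFDerivAt (fun y : Fin n → EuclideanSpace ℝ (Fin 3) => ‖y i‖ ^ p)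
      ((p / 2 * (‖x i‖ ^ 2) ^ (p / 2 - 1)) •
        ((2 : ℕ) • (innerSL ℝ (x i)).comp (ContinuousLinearMap.proj (R := ℝ) i))) x := by
  have hfun : (fun y : Fin n → EuclideanSpace ℝ (Fin 3) => ‖y i‖ ^ p)
      = fun y => (‖y i‖ ^ 2) ^ (p / 2) := by
    funext y; exact norm_rpow_eq_norm_sq_rpow (y i) p
  rw [hfun]
  have h1 : HasFDerivAt (fun (f : Fin n → EuclideanSpace ℝ (Fin 3)) => f i)
      (ContinuousLinearMap.proj (R := ℝ) i) x := hasFDerivAt_apply i x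
  have h2 := h1.norm_sq
  have hne : ‖x i‖ ^ 2 ≠ 0 := by have := norm_pos_iff.2 hx; positivity
  exact h2.rpow_const (Or.inl hne)

/-- **Derivative of the norm weight.** At a configuration avoiding the origin, `x ↦ ∏ᵢ ‖xᵢ‖^p` is
differentiable and `D(∏ᵢ ‖xᵢ‖^p)(x)[v] = p (Σᵢ ⟪xᵢ, vᵢ⟫/‖xᵢ‖²) ∏ᵢ ‖xᵢ‖^p`. [folklore] -/
theorem fderiv_normWeight {x : Fin n → EuclideanSpace ℝ (Fin 3)} (hx : ∀ i, x i ≠ 0) (p : ℝ)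
    (v : Fin n → EuclideanSpace ℝ (Fin 3)) :
    DifferentiableAt ℝ (fun y : Fin n → EuclideanSpace ℝ (Fin 3) => ∏ i, ‖y i‖ ^ p) x ∧
    fderiv ℝ (fun y : Fin n → EuclideanSpace ℝ (Fin 3) => ∏ i, ‖y i‖ ^ p) x v
      = p * (∑ i, ⟪x i, v i⟫ / ‖x i‖ ^ 2) * ∏ i, ‖x i‖ ^ p := by
  classical
  have key := HasFDerivAt.finsetProd (u := Finset.univ)
    (fun i _ => hasFDerivAt_norm_apply_rpow i (hx i) p)
  refine ⟨key.differentiableAt, ?_⟩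
  rw [key.fderiv]
  simp only [FunLike.coe_sum, Finset.sum_apply, smul_apply,
    ContinuousLinearMap.comp_apply,
    ContinuousLinearMap.proj_apply, innerSL_apply_apply, smul_eq_mul, nsmul_eq_mul,
    Nat.cast_ofNat, Finset.mul_sum, Finset.sum_mul]
  refine Finset.sum_congr rfl fun i _ => ?_
  have hxi : 0 < ‖x i‖ ^ 2 := by have := norm_pos_iff.2 (hx i); positivity
  have hsplit : (‖x i‖ ^ 2) ^ (p / 2 - 1) = ‖x i‖ ^ p / ‖x i‖ ^ 2 := by
    rw [Real.rpow_sub hxi, Real.rpow_one, ← norm_rpow_eq_norm_sq_rpow]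
  rw [hsplit, ← Finset.prod_erase_mul _ _ (Finset.mem_univ i)]
  field_simp

/-! ### Smoothness away from the origin -/

/-- The norm weight is smooth at configurations avoiding the origin. [folklore] -/
theorem contDiffAt_normWeight {x : Fin n → EuclideanSpace ℝ (Fin 3)} (hx : ∀ i, x i ≠ 0)
    (p : ℝ) {m : ℕ∞} :
    ContDiffAt ℝ m (fun y : Fin n → EuclideanSpace ℝ (Fin 3) => ∏ i, ‖y i‖ ^ p) x :=
  contDiffAt_prod fun i _ =>
    (((contDiffAt_apply ℝ (EuclideanSpace ℝ (Fin 3)) (n := m) i x).norm ℝ (hx i)).rpow_const_of_ne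
      (norm_ne_zero_iff.2 (hx i)))

/-- The coordinatewise inversion is smooth at configurations avoiding the origin. [folklore] -/
theorem contDiffAt_invConfig {x : Fin n → EuclideanSpace ℝ (Fin 3)} (hx : ∀ i, x i ≠ 0)
    {m : ℕ∞} :
    ContDiffAt ℝ m (fun (y : Fin n → EuclideanSpace ℝ (Fin 3)) i =>
      inversion (0 : EuclideanSpace ℝ (Fin 3)) 1 (y i)) x :=
  contDiffAt_pi.2 fun i =>
    ContDiffAt.inversion contDiffAt_const contDiffAt_const
      (contDiffAt_apply ℝ (EuclideanSpace ℝ (Fin 3)) i x) (hx i)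

/-- The coordinatewise inversion is continuous on the configurations avoiding the origin.
[folklore] -/
theorem continuousOn_invConfig :
    ContinuousOn (fun (y : Fin n → EuclideanSpace ℝ (Fin 3)) i =>
      inversion (0 : EuclideanSpace ℝ (Fin 3)) 1 (y i)) {x | ∀ i, x i ≠ 0} :=
  fun _ hx => ((contDiffAt_invConfig hx (m := 0)).continuousAt).continuousWithinAt

/-- The coordinatewise inversion maps the open set `U₀` of non-coincident configurations
avoiding the origin into itself. [folklore] -/
theorem invConfig_mem_U0 {x : Fin n → EuclideanSpace ℝ (Fin 3)}
    (hx : x ∈ {x | x ∈ NonCoincident 3 n ∧ ∀ i, x i ≠ 0}) :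
    (fun i => inversion (0 : EuclideanSpace ℝ (Fin 3)) 1 (x i)) ∈
      {x | x ∈ NonCoincident 3 n ∧ ∀ i, x i ≠ 0} := by
  refine ⟨?_, fun i => inversion_zero_one_ne_zero (hx.2 i)⟩
  simp only [mem_nonCoincident]
  exact (inversion_injective (0 : EuclideanSpace ℝ (Fin 3)) one_ne_zero).comp hx.1

/-- The derivative of the coordinatewise inversion maps the special-conformal vector field
`W_a(y) = (‖yᵢ‖² a − 2⟪a, yᵢ⟫ yᵢ)ᵢ` to the constant field `(a, …, a)` (coordinatewise
`fderiv_inversion_sct`). [folklore] -/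
theorem fderiv_invConfig_sct {y : Fin n → EuclideanSpace ℝ (Fin 3)} (hy : ∀ i, y i ≠ 0)
    (a : EuclideanSpace ℝ (Fin 3)) :
    fderiv ℝ (fun (z : Fin n → EuclideanSpace ℝ (Fin 3)) i =>
        inversion (0 : EuclideanSpace ℝ (Fin 3)) 1 (z i)) y
      (fun i => ‖y i‖ ^ 2 • a - (2 * ⟪a, y i⟫) • y i) = fun _ => a := by
  rw [(hasFDerivAt_invConfig hy).fderiv]
  funext i
  simp only [ContinuousLinearMap.pi_apply, ContinuousLinearMap.comp_apply,
    ContinuousLinearMap.proj_apply]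
  exact fderiv_inversion_sct (hy i) a

/-! ### Test functions compactly supported in `U₀` -/

/-- Multiplying a test function compactly supported in `U₀` by a norm weight gives a test function
compactly supported in `U₀`, with the expected directional derivatives. [folklore] -/
theorem testFunction_normWeight_mul (q : ℝ) {φ : (Fin n → EuclideanSpace ℝ (Fin 3)) → ℝ}
    (hφ : ContDiff ℝ ((⊤ : ℕ∞) : WithTop ℕ∞) φ) (hφc : HasCompactSupport φ)
    (hφU : tsupport φ ⊆
      {x | x ∈ NonCoincident 3 n ∧ ∀ i, x i ≠ 0}) :
    ContDiff ℝ ((⊤ : ℕ∞) : WithTop ℕ∞)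
        (fun x : Fin n → EuclideanSpace ℝ (Fin 3) => (∏ i, ‖x i‖ ^ q) * φ x) ∧
      HasCompactSupport (fun x : Fin n → EuclideanSpace ℝ (Fin 3) => (∏ i, ‖x i‖ ^ q) * φ x) ∧
      tsupport (fun x : Fin n → EuclideanSpace ℝ (Fin 3) => (∏ i, ‖x i‖ ^ q) * φ x) ⊆
        {x | x ∈ NonCoincident 3 n ∧ ∀ i, x i ≠ 0} ∧
      ∀ x v, fderiv ℝ (fun x : Fin n → EuclideanSpace ℝ (Fin 3) => (∏ i, ‖x i‖ ^ q) * φ x) x v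
        = q * (∑ i, ⟪x i, v i⟫ / ‖x i‖ ^ 2) * (∏ i, ‖x i‖ ^ q) * φ x
          + (∏ i, ‖x i‖ ^ q) * fderiv ℝ φ x v := by
  have hsupp : tsupport (fun x : Fin n → EuclideanSpace ℝ (Fin 3) => (∏ i, ‖x i‖ ^ q) * φ x)
      ⊆ tsupport φ := tsupport_mul_subset_right
  refine ⟨?_, hφc.mul_left, hsupp.trans hφU, ?_⟩
  · refine contDiff_iff_contDiffAt.2 fun x => ?_
    by_cases hx : ∀ i, x i ≠ 0
    · exact (contDiffAt_normWeight hx q).mul hφ.contDiffAt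
    · have hx' : x ∉ tsupport fun x : Fin n → EuclideanSpace ℝ (Fin 3) => (∏ i, ‖x i‖ ^ q) * φ x :=
        fun h => hx (hφU (hsupp h)).2
      exact contDiffAt_const.congr_of_eventuallyEq (notMem_tsupport_iff_eventuallyEq.1 hx')
  · intro x v
    by_cases hx : ∀ i, x i ≠ 0
    · obtain ⟨hdiff, hformula⟩ := fderiv_normWeight hx q v
      rw [fderiv_fun_mul hdiff (hφ.differentiable (by simp) x)]
      simp only [_root_.add_apply, FunLike.coe_smul, Pi.smul_apply,
        smul_eq_mul, hformula]
      ring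
    · have hxφ : x ∉ tsupport φ := fun h => hx (hφU h).2
      have hx' : x ∉ tsupport fun x : Fin n → EuclideanSpace ℝ (Fin 3) => (∏ i, ‖x i‖ ^ q) * φ x :=
        fun h => hxφ (hsupp h)
      simp [fderiv_of_notMem_tsupport (𝕜 := ℝ) hx', fderiv_of_notMem_tsupport (𝕜 := ℝ) hxφ,
        image_eq_zero_of_notMem_tsupport hxφ]

/-- Composing a test function compactly supported in `U₀` with the coordinatewise inversion gives a
test function compactly supported in `U₀`, whose derivative along the special-conformal field
`W_a` is the derivative of the original along the constant field `(a,…,a)` at the inverted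
configuration (`K_a = ι P_a ι`, Di Francesco–Mathieu–Sénéchal 1997 §4.1). [folklore] -/
theorem testFunction_comp_invConfig {g : (Fin n → EuclideanSpace ℝ (Fin 3)) → ℝ}
    (hg : ContDiff ℝ ((⊤ : ℕ∞) : WithTop ℕ∞) g) (hgc : HasCompactSupport g)
    (hgU : tsupport g ⊆
      {x | x ∈ NonCoincident 3 n ∧ ∀ i, x i ≠ 0}) :
    ContDiff ℝ ((⊤ : ℕ∞) : WithTop ℕ∞) (fun y : Fin n → EuclideanSpace ℝ (Fin 3) =>
        g (fun i => inversion (0 : EuclideanSpace ℝ (Fin 3)) 1 (y i))) ∧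
      HasCompactSupport (fun y : Fin n → EuclideanSpace ℝ (Fin 3) =>
        g (fun i => inversion (0 : EuclideanSpace ℝ (Fin 3)) 1 (y i))) ∧
      tsupport (fun y : Fin n → EuclideanSpace ℝ (Fin 3) =>
        g (fun i => inversion (0 : EuclideanSpace ℝ (Fin 3)) 1 (y i))) ⊆
        {x | x ∈ NonCoincident 3 n ∧ ∀ i, x i ≠ 0} ∧
      ∀ (a : EuclideanSpace ℝ (Fin 3)) (y : Fin n → EuclideanSpace ℝ (Fin 3)),
        fderiv ℝ (fun y : Fin n → EuclideanSpace ℝ (Fin 3) =>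
            g (fun i => inversion (0 : EuclideanSpace ℝ (Fin 3)) 1 (y i))) y
          (fun i => ‖y i‖ ^ 2 • a - (2 * ⟪a, y i⟫) • y i)
        = fderiv ℝ g (fun i => inversion (0 : EuclideanSpace ℝ (Fin 3)) 1 (y i)) (fun _ => a) := by
  set ι : (Fin n → EuclideanSpace ℝ (Fin 3)) → (Fin n → EuclideanSpace ℝ (Fin 3)) :=
    fun y i => inversion (0 : EuclideanSpace ℝ (Fin 3)) 1 (y i) with hι
  set U₀ : Set (Fin n → EuclideanSpace ℝ (Fin 3)) :=
    {x | x ∈ NonCoincident 3 n ∧ ∀ i, x i ≠ 0} with hU₀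
  have hιι : ∀ x, ι (ι x) = x := invConfig_invConfig
  -- the compact set `ι '' tsupport g` contains the support of `g ∘ ι`
  have hK : IsCompact (ι '' tsupport g) :=
    hgc.image_of_continuousOn (continuousOn_invConfig.mono fun x hx => (hgU hx).2)
  have hKU : ι '' tsupport g ⊆ U₀ := by
    rintro _ ⟨x, hx, rfl⟩; exact invConfig_mem_U0 (hgU hx)
  have hsuppK : tsupport (fun y => g (ι y)) ⊆ ι '' tsupport g := by
    refine closure_minimal (fun y hy => ?_) hK.isClosed
    exact ⟨ι y, subset_tsupport _ hy, hιι y⟩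
  have hsmooth : ContDiff ℝ ((⊤ : ℕ∞) : WithTop ℕ∞) fun y => g (ι y) := by
    refine contDiff_iff_contDiffAt.2 fun y => ?_
    by_cases hy : ∀ i, y i ≠ 0
    · exact hg.contDiffAt.comp y (contDiffAt_invConfig hy)
    · have hy' : y ∉ tsupport fun y => g (ι y) := fun h => hy (hKU (hsuppK h)).2
      exact contDiffAt_const.congr_of_eventuallyEq (notMem_tsupport_iff_eventuallyEq.1 hy')
  refine ⟨hsmooth, IsCompact.of_isClosed_subset hK (isClosed_tsupport _) hsuppK,
    hsuppK.trans hKU, fun a y => ?_⟩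
  by_cases hy : ∀ i, y i ≠ 0
  · have hd : HasFDerivAt (fun y => g (ι y)) ((fderiv ℝ g (ι y)).comp (fderiv ℝ ι y)) y :=
      (hg.differentiable (by simp) _).hasFDerivAt.comp y
        (hasFDerivAt_invConfig hy).differentiableAt.hasFDerivAt
    rw [hd.fderiv, ContinuousLinearMap.comp_apply, fderiv_invConfig_sct hy a]
  · have hy' : y ∉ tsupport fun y => g (ι y) := fun h => hy (hKU (hsuppK h)).2
    have hιy : ι y ∉ tsupport g := by
      intro h
      obtain ⟨i, hi⟩ := not_forall.1 hy
      apply (hgU h).2 i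
      simp only [hι, not_not] at hi ⊢
      rw [hi, inversion_self]
    rw [fderiv_of_notMem_tsupport (𝕜 := ℝ) hy', fderiv_of_notMem_tsupport (𝕜 := ℝ) hιy]
    rfl

/-- `⟪ι y, a⟫ / ‖ι y‖² = ⟪y, a⟫` for the unit inversion (both sides vanish at `y = 0`).
[folklore] -/
theorem inner_inversion_div_norm_sq (y a : EuclideanSpace ℝ (Fin 3)) :
    ⟪inversion (0 : EuclideanSpace ℝ (Fin 3)) 1 y, a⟫
        / ‖inversion (0 : EuclideanSpace ℝ (Fin 3)) 1 y‖ ^ 2 = ⟪y, a⟫ := by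
  by_cases hy : y = 0
  · subst hy; simp
  · have hyn : ‖y‖ ≠ 0 := norm_ne_zero_iff.2 hy
    rw [norm_inversion_zero_one, inversion_zero_one_eq, inner_smul_left]
    simp only [conj_trivial, inv_pow]
    field_simp

/-! ### The pull-back of the Ward identity -/

/-- **Weak translation invariance of the weighted pull-back.** If `Sₙ` satisfies the weak
special-conformal Ward identity with weight `Δ` (tested against smooth functions compactly
supported in the non-coincident configurations), then
`x ↦ (∏ᵢ ‖xᵢ‖^{-2Δ}) Sₙ(ιₙ x)` is weakly translation invariant on
`U₀ = {x non-coincident, all xᵢ ≠ 0}`: `∫ (∏ᵢ ‖xᵢ‖^{-2Δ}) Sₙ(ιₙ x) ∂_a φ(x) dx = 0` for all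
`a ∈ ℝ³` and all smooth `φ` compactly supported in `U₀`. This is `K_a = ι P_a ι`
(Di Francesco–Mathieu–Sénéchal 1997, §4.1 (4.14)–(4.18)) at the level of weak identities: test
the Ward identity against `((∏ᵢ ‖·ᵢ‖^{6−2Δ}) φ) ∘ ιₙ` and change variables `y = ιₙ x`.
[folklore] -/
theorem weak_translation_invariant_pullback
    {Sn : (Fin n → EuclideanSpace ℝ (Fin 3)) → ℝ} {Δ : ℝ}
    (hward : ∀ (b : EuclideanSpace ℝ (Fin 3)) (φ : (Fin n → EuclideanSpace ℝ (Fin 3)) → ℝ),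
      ContDiff ℝ ((⊤ : ℕ∞) : WithTop ℕ∞) φ → HasCompactSupport φ →
      tsupport φ ⊆ NonCoincident 3 n →
      ∫ x, Sn x * ((2 * Δ - 6) * (∑ i, ⟪b, x i⟫) * φ x +
        fderiv ℝ φ x (fun i => ‖x i‖ ^ 2 • b - (2 * ⟪b, x i⟫) • x i)) = 0)
    (a : EuclideanSpace ℝ (Fin 3)) (φ : (Fin n → EuclideanSpace ℝ (Fin 3)) → ℝ)
    (hφ : ContDiff ℝ ((⊤ : ℕ∞) : WithTop ℕ∞) φ) (hφc : HasCompactSupport φ)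
    (hφU : tsupport φ ⊆ {x | x ∈ NonCoincident 3 n ∧ ∀ i, x i ≠ 0}) :
    ∫ x : Fin n → EuclideanSpace ℝ (Fin 3),
      ((∏ i, ‖x i‖ ^ (-(2 * Δ))) * Sn (fun i => inversion (0 : EuclideanSpace ℝ (Fin 3)) 1 (x i)))
        * fderiv ℝ φ x (fun _ => a) = 0 := by
  set ι : (Fin n → EuclideanSpace ℝ (Fin 3)) → (Fin n → EuclideanSpace ℝ (Fin 3)) :=
    fun y i => inversion (0 : EuclideanSpace ℝ (Fin 3)) 1 (y i) with hι
  have hιι : ∀ x, ι (ι x) = x := invConfig_invConfig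
  set q : ℝ := 6 - 2 * Δ with hq
  obtain ⟨hg, hgc, hgU, hgd⟩ := testFunction_normWeight_mul q hφ hφc hφU
  obtain ⟨hψ, hψc, hψU, hψd⟩ := testFunction_comp_invConfig hg hgc hgU
  have key := hward a _ hψ hψc (hψU.trans fun x hx => hx.1)
  -- the Ward integrand against `ψ` collapses to `Sₙ(y) · (∏ ‖ι yᵢ‖^q) · ∂_a φ(ι y)`
  have hpt : ∀ y : Fin n → EuclideanSpace ℝ (Fin 3),
      Sn y * ((2 * Δ - 6) * (∑ i, ⟪a, y i⟫) * ((∏ i, ‖ι y i‖ ^ q) * φ (ι y)) +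
        fderiv ℝ (fun y : Fin n → EuclideanSpace ℝ (Fin 3) => (∏ i, ‖ι y i‖ ^ q) * φ (ι y)) y
          (fun i => ‖y i‖ ^ 2 • a - (2 * ⟪a, y i⟫) • y i))
      = Sn y * ((∏ i, ‖ι y i‖ ^ q) * fderiv ℝ φ (ι y) (fun _ => a)) := by
    intro y
    rw [hψd a y, hgd (ι y) (fun _ => a)]
    have hsum : ∑ i, ⟪ι y i, a⟫ / ‖ι y i‖ ^ 2 = ∑ i, ⟪a, y i⟫ :=
      Finset.sum_congr rfl fun i _ => by rw [hι, inner_inversion_div_norm_sq, real_inner_comm]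
    rw [hsum, hq]
    ring
  have key' : ∫ y, Sn y * ((∏ i, ‖ι y i‖ ^ q) * fderiv ℝ φ (ι y) (fun _ => a)) = 0 := by
    rw [← key]; congr 1; funext y; exact (hpt y).symm
  -- change variables `y = ι x`
  rw [integral_comp_invConfig] at key'
  rw [← key']
  refine integral_congr_ae (Filter.Eventually.of_forall fun x => ?_)
  have hx2 : ι (fun i => inversion (0 : EuclideanSpace ℝ (Fin 3)) 1 (x i)) = x := hιι x
  beta_reduce
  rw [hx2]
  by_cases hx : ∀ i, x i ≠ 0
  · have hw : (∏ i, ‖x i‖ ^ (-6 : ℝ)) * ∏ i, ‖x i‖ ^ q = ∏ i, ‖x i‖ ^ (-(2 * Δ)) := by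
      rw [normWeight_mul hx, hq]; congr 1; ext i; congr 1; ring
    rw [← hw]; ring
  · have hxφ : x ∉ tsupport φ := fun h => hx (hφU h).2
    simp [fderiv_of_notMem_tsupport (𝕜 := ℝ) hxφ]

end Summit.CriticalPhenomena.Ising3DConformalLimit.WardToMoebius
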